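import Summits.Schanuel.Schanuel.Theorems.RootDecomp1HBlockClearance
import Summits.Schanuel.Schanuel.Theorems.RootDecomp1HClearance

/-!
# RootDecomp1H — THE TRANSVERSE WITNESS, part 1 of 3 (§1–§3: closure properties of a curve-closed subspace,
# rigid self-absorbing configurations are transverse, the witness abscissa `a₀`)

All three parts (`RootDecomp1HWitnessCore` §1–§3, `RootDecomp1HWitnessRigid` §4–§6, `RootDecomp1HWitness` §7–§10) share the
namespace `Summit.Schanuel.Schanuel.Theorems.RootDecomp1HWitness`; importers use the last part.

## RootDecomp1H — THE TRANSVERSE WITNESS (lens-5 cell decomp-schanuel, generation 8; `--supports stmt-Schanuel-30564`)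

An explicit, conjugation-stable, `ℚ`-free rank-3 Khovanskii configuration

  `W₃ = (a₀, √2·a₀, i·a₀)`,   `a₀ ∈ (0, 4)` the real root of `e^{√2 a} = e^{a} + 1`,

and the theorem that in every world where the route's structural side `ProductSchanuel ∧ RelTowerSchanuel` holds (equivalently:
where Schanuel holds on the hull `𝓚 = curveHull`), `W₃` lies in NO `ℚ`-span of a `ℚ`-free tower tuple: it stands clear of the hull
that the finite/structural side of the decomposition `Schanuel ⟺ S|𝓚 ∧ BridgeTransverse` exhausts.  `W₃` meets every hypothesis
of the declared residual `BridgeTransverse` at `(n, y) = (3, W₃)` that does not itself assert an open transcendence statement —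
star-presentable at its optimal complexity (`starPresentable_W₃`), conjugation-stable (`conj_W₃_mem_span`), outside the tower hull
(`not_inTowerHull_W₃_of_structural`) — and lies in `𝓒 = ecl ∅` (`W₃_mem_ecl`), at the minimal off-hull rank `3` (g7 clearance).
The two remaining hypotheses (`∀ m < 3, SchanuelRank m` and "`W₃` is a counterexample", i.e. `trdeg ℚ(a₀, e^{a₀}, e^{i a₀}) ≤ 2`)
are open transcendence statements (the second is refuted by Schanuel itself).  So the residual's geometric hypotheses are jointly
satisfiable off `𝓚` — the cut `S|𝓚 / BridgeTransverse` is not vacuous on the transverse side — and `𝓚` does not swallow `𝓒`.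

## Main results
* `exists_root`, `a₀`, `W₃`, `linearIndependent_W₃`, `conj_W₃_mem_span` — the configuration; `ℚ`-free; closed under conjugation.
* `khovanskii_certificate`, `det_jacobian_gW` — the rational Khovanskii system `gW = (X₁² − 2X₀², X₂² + X₀², Y₁ − Y₀ − 1)` vanishes
  at `(W₃, e^{W₃})` with exponential Jacobian `4·i·a₀²·((2 − √2)e^{a₀} + 2) ≠ 0`; `starPresentable_W₃` — the first inline hypothesis
  of `BridgeTransverse` (complexity-optimal presentation, `‖W₃‖ ≤ 4^c`) at `y = W₃`; `isSol_W₃`, `W₃_mem_ecl` — `W₃ ⊂ ecl ∅`.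
* `inf_towerSpan_eq_bot` — THE TRANSVERSALITY MECHANISM (general `n`): under `SchanuelOn 𝓚`, a `ℚ`-free `y : Fin n → ℂ` that is
  RIGID with budget `s ≤ n − 2` (`Rigid y s`: over any field containing one non-zero span vector `v`, `e^{v}` and `s` further
  numbers, all of `y, e^{y}` are algebraic) and SELF-ABSORBING (`SelfAbsorbing 𝓚 y`: `𝓚 ∋ v ≠ 0`, `v ∈ span y` ⇒ `y ⊂ 𝓚`) meets
  every tower span only in `0`.  Proof, by induction on the tower `b` (length `N + 1`, prefix `b'` disjoint from `span y` by
  induction): towers lie in `𝓚`, so a non-zero `v ∈ span y ∩ span b` lies in `𝓚`, so `y ⊂ 𝓚`; then `b' ⊕ y` is a `ℚ`-free family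
  in `𝓚` of rank `N + n`, and Schanuel on `𝓚` gives `trdeg ≥ N + n`, while rigidity along `v` makes everything algebraic over
  `ℚ(b, e^{b}, e^{v}, x)`, of `trdeg ≤ (N + 1) + s < N + n`.
* `isAlgebraic_of_monomial_mem` — "no hidden constants": `e^{p}(e+1)^{q} ∈ K`, `(p, q) ≠ (0, 0)` ⇒ `e` algebraic over `K`;
  whence `rigid_W₃ : Rigid W₃ 1` and `selfAbsorbing_W₃`.
* `not_inTowerHull_W₃_of_structural : ProductSchanuel → RelTowerSchanuel → ¬ InTowerHull W₃`; `not_inTowerHull_W₃_of_schanuel`;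
  `W₃_transverse : span_ℚ W₃ ∩ 𝓚 = 0`; `a₀_not_mem_curveHull`.
* `ecl_not_subset_curveHull` — DICHOTOMY: `S|𝓚 ⇒ 𝓒 ⊄ 𝓚`; contrapositively `𝓒 ⊆ 𝓚 ⇒ ¬ Schanuel`.
* WALL: `inTowerHull_W₃_of_trdeg_le_one` / `one_lt_trdeg_of_not_inTowerHull` / `one_lt_trdeg_of_not_mem` — an unconditional proof
  of `¬ InTowerHull W₃` would prove the open rank-two Schanuel instance `trdeg ℚ(a₀, e^{a₀}) = 2`; the conditional form is honest.
-/

set_option linter.dupNamespace false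

noncomputable section

namespace Summit.Schanuel.Schanuel.Theorems.RootDecomp1HWitness

open Complex Set
open Literature.NumberTheory.Transcendental (exists_nsmul_mem_span_int mem_adjoin_of_mem_span_int ecl Khovanskii.ePD
  Khovanskii.IsSol Khovanskii.kpt Khovanskii.kjac Khovanskii.polyOver Khovanskii.X_mem_polyOver Khovanskii.mem_ecl_iff
  Khovanskii.ePD_map_of_ringHom)
open Summit.Schanuel.Schanuel.Theses.RootDecomp1H (ProductSchanuel RelTowerSchanuel BridgeTransverse)
open Summit.Schanuel.Schanuel.Theorems.RootDecomp1HTowerCells (trdeg_adjoin_adjoin_eq trdeg_adjoin_union_le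
  trdeg_adjoin_range_le)
open Summit.Schanuel.Schanuel.Theorems.RootDecomp1HCurveHull
open Summit.Schanuel.Schanuel.Theorems.RootDecomp1HClearance (InTowerHull)
open Summit.Schanuel.Schanuel.Theorems.RootDecomp1HBlockClearance (trdeg_pairRange_lt_aleph0)

/-! ## 1. Three closure properties of a curve-closed subspace -/

/-- Adjoining elements algebraic over `K(S)` does not change the transcendence degree (relative form of
`Literature.Barriers.Schanuel.trdeg_adjoin_union_eq_of_isAlgebraic`; same twelve-line proof as the copy in
`Literature.Barriers.Schanuel.NesterenkoModularScopeConjectureProofs`, which is kept out of this file's import cone). [folklore] -/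
theorem trdeg_adjoin_union_eq_of_isAlgebraic_adjoin {K E : Type*} [Field K] [Field E]
    [Algebra K E] (S T : Set E) (hT : ∀ x ∈ T, IsAlgebraic (IntermediateField.adjoin K S) x) :
    Algebra.trdeg K (IntermediateField.adjoin K (S ∪ T)) = Algebra.trdeg K (IntermediateField.adjoin K S) := by
  haveI : FaithfulSMul (IntermediateField.adjoin K S) (IntermediateField.adjoin (IntermediateField.adjoin K S) T) :=
    (faithfulSMul_iff_algebraMap_injective (IntermediateField.adjoin K S)
      (IntermediateField.adjoin (IntermediateField.adjoin K S) T)).mpr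
      (algebraMap (IntermediateField.adjoin K S) (IntermediateField.adjoin (IntermediateField.adjoin K S) T)).injective
  have htower := trdeg_add_eq K (IntermediateField.adjoin K S) (A := IntermediateField.adjoin (IntermediateField.adjoin K S) T)
  have heq : Algebra.trdeg K (IntermediateField.adjoin (IntermediateField.adjoin K S) T) =
      Algebra.trdeg K (IntermediateField.adjoin K (S ∪ T)) := by
    rw [← (IntermediateField.equivOfEq (IntermediateField.adjoin_adjoin_left K S T)).trdeg_eq]
    rfl
  haveI : Algebra.IsAlgebraic (IntermediateField.adjoin K S) (IntermediateField.adjoin (IntermediateField.adjoin K S) T) :=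
    IntermediateField.isAlgebraic_adjoin fun x hx => (hT x hx).isIntegral
  have h0 : Algebra.trdeg (IntermediateField.adjoin K S) (IntermediateField.adjoin (IntermediateField.adjoin K S) T) = 0 :=
    trdeg_eq_zero
  rw [h0, add_zero, heq] at htower
  exact htower.symm

/-- **ABSORPTION OF ONE STOREY** (absolute form of 1J's curve condition): if `v ⊂ K` is finite, `K` curve-closed, and
`trdeg ℚ(v, w, e^v, e^w) ≤ trdeg ℚ(v, e^v) + 1`, then `w ∈ K`. -/
theorem mem_of_isCurveClosed_of_trdeg_le {K : Submodule ℚ ℂ} (hK : IsCurveClosed K) {m : ℕ} (v : Fin m → ℂ)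
    (hv : ∀ l, v l ∈ K) {w : ℂ}
    (habs : Algebra.trdeg ℚ ↥(IntermediateField.adjoin ℚ ((range v ∪ range (cexp ∘ v)) ∪ ({w, cexp w} : Set ℂ))) ≤
      Algebra.trdeg ℚ ↥(IntermediateField.adjoin ℚ (range v ∪ range (cexp ∘ v))) + 1) : w ∈ K := by
  classical
  set Y : Finset ℂ := Finset.univ.image v with hYdef
  have hY : (↑Y : Set ℂ) ⊆ ↑K := by
    intro z hz
    obtain ⟨l, -, rfl⟩ := Finset.mem_image.mp (Finset.mem_coe.mp hz)
    exact hv l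
  refine mem_of_isCurveClosed hK hY ?_
  have hYset : (↑Y : Set ℂ) ∪ cexp '' ↑Y = range v ∪ range (cexp ∘ v) := by
    have h1 : (↑Y : Set ℂ) = range v := by
      rw [hYdef, Finset.coe_image, Finset.coe_univ, Set.image_univ]
    rw [h1, ← Set.range_comp]
  rw [curveCond_iff_of_eq hYset]
  have htower := trdeg_adjoin_adjoin_eq (K := ℚ) (E := ℂ) (range v ∪ range (cexp ∘ v)) ({w, cexp w} : Set ℂ)
  have hfin := trdeg_pairRange_lt_aleph0 v
  have h1 := htower.le.trans habs
  have h2 := ((add_comm _ _).le.trans h1).trans (add_comm _ _).le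
  have h3 := (Cardinal.add_le_add_iff_of_lt_aleph0 hfin).1 h2
  simpa using h3

/-- **A CURVE-CLOSED SUBSPACE IS CLOSED UNDER ALGEBRAIC SCALARS**: `u ∈ K`, `μ ∈ ℚ̄` ⟹ `μ·u ∈ K`. -/
theorem algebraic_mul_mem {K : Submodule ℚ ℂ} (hK : IsCurveClosed K) {u : ℂ} (hu : u ∈ K) {μ : ℂ}
    (hμ : IsAlgebraic ℚ μ) : μ * u ∈ K :=
  mem_of_isCurveClosed_of_trdeg_le hK ![u] (fun l => by fin_cases l; exact hu)
    (trdeg_adjoin_pair_le_of_baker hμ (IntermediateField.subset_adjoin ℚ _ (Or.inl ⟨0, rfl⟩)))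

/-- **DEPTH-ONE NUMBERS LIE IN EVERY CURVE-CLOSED SUBSPACE** (`trdeg ℚ(z, e^z) ≤ 1 ⟹ z ∈ K`). -/
theorem mem_of_depthOne {K : Submodule ℚ ℂ} (hK : IsCurveClosed K) {z : ℂ}
    (hz : Algebra.trdeg ℚ ↥(IntermediateField.adjoin ℚ ({z, cexp z} : Set ℂ)) ≤ 1) : z ∈ K := by
  refine mem_of_isCurveClosed_of_trdeg_le hK (Fin.elim0 : Fin 0 → ℂ) (fun l => l.elim0) ?_
  have h0 : range (Fin.elim0 : Fin 0 → ℂ) ∪ range (cexp ∘ (Fin.elim0 : Fin 0 → ℂ)) = ∅ := by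
    rw [Set.range_eq_empty, Set.range_eq_empty, Set.empty_union]
  rw [h0, Set.empty_union]
  exact hz.trans le_add_self

/-- The exponential of an element of the `ℚ`-span of `b` is algebraic over `ℚ(b, e^b)`. -/
theorem isAlgebraic_exp_of_mem_span {ι : Type*} (b : ι → ℂ) {v : ℂ} (hv : v ∈ Submodule.span ℚ (range b)) :
    IsAlgebraic (IntermediateField.adjoin ℚ (range b ∪ range (cexp ∘ b))) (cexp v) := by
  obtain ⟨M, hM, hMv⟩ := exists_nsmul_mem_span_int b hv
  have hmem := (mem_adjoin_of_mem_span_int b hMv).2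
  have hpow : cexp ((M : ℚ) • v) = cexp v ^ M := by
    rw [Rat.smul_def, Rat.cast_natCast, Complex.exp_nat_mul]
  refine IsAlgebraic.of_pow (Nat.pos_of_ne_zero hM) ?_
  rw [← hpow]
  exact isAlgebraic_algebraMap (⟨_, hmem⟩ : IntermediateField.adjoin ℚ (range b ∪ range (cexp ∘ b)))

/-! ## 2. Rigid self-absorbing configurations are transverse to the hull -/

/-- `y` is RIGID WITH BUDGET `s`: along EVERY non-zero direction `v ∈ span_ℚ y`, the whole configuration `(y, e^y)` is
algebraic over `ℚ(v, e^v)` and at most `s` further numbers. -/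
def Rigid {n : ℕ} (y : Fin n → ℂ) (s : ℕ) : Prop :=
  ∀ v ∈ Submodule.span ℚ (range y), v ≠ 0 → ∃ x : Fin s → ℂ, ∀ K : IntermediateField ℚ ℂ,
    v ∈ K → cexp v ∈ K → (∀ i, x i ∈ K) → ∀ w ∈ range y ∪ range (cexp ∘ y), IsAlgebraic K w

/-- `y` is SELF-ABSORBING for `K`: if one non-zero vector of `span_ℚ y` lies in `K` then all of `y` does. -/
def SelfAbsorbing (K : Submodule ℚ ℂ) {n : ℕ} (y : Fin n → ℂ) : Prop :=
  ∀ v ∈ Submodule.span ℚ (range y), v ≠ 0 → v ∈ K → ∀ j, y j ∈ K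

/-- **RIGIDITY ⟹ CLEARANCE.**  Under Schanuel on the hull `𝓚`, a `ℚ`-free, rigid (budget `s ≤ n − 2`), self-absorbing
`n`-tuple `y` has span meeting the span of EVERY `ℚ`-free tower tuple trivially.  Induction on the length of the tower: at the
first storey where the tower span meets `span y`, the free family `(prefix, y) ⊂ 𝓚` has `trdeg ≥ N + n` by Schanuel on `𝓚`,
but `≤ (N + 1) + s` by rigidity along the meeting direction. -/
theorem inf_towerSpan_eq_bot (hS : SchanuelOn curveHull) {n s : ℕ} (hsn : s + 2 ≤ n) {y : Fin n → ℂ}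
    (hy : LinearIndependent ℚ y) (hR : Rigid y s) (hA : SelfAbsorbing curveHull y) :
    ∀ (N : ℕ) (b : Fin N → ℂ), LinearIndependent ℚ b → TowerTuple b →
      ∀ v ∈ Submodule.span ℚ (range y), v ∈ Submodule.span ℚ (range b) → v = 0 := by
  intro N
  induction N with
  | zero =>
    intro b _ _ v _ hvb
    rw [Set.range_eq_empty b, Submodule.span_empty] at hvb
    exact (Submodule.mem_bot ℚ).1 hvb
  | succ N ih =>
    intro b hb htow v hvy hvb
    by_contra hv0
    -- the prefix `b'`; by induction its span misses `span y`
    set b' : Fin N → ℂ := b ∘ Fin.castSucc with hb'def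
    have hb' : LinearIndependent ℚ b' := hb.comp _ (Fin.castSucc_injective N)
    have hb'tow : TowerTuple b' := towerTuple_castSucc htow
    have hdisj : Disjoint (Submodule.span ℚ (range b')) (Submodule.span ℚ (range y)) := by
      rw [Submodule.disjoint_def]
      intro x hxb' hxy
      exact ih b' hb' hb'tow x hxy hxb'
    -- `b ⊂ 𝓚`, so `v ∈ 𝓚`, so `y ⊂ 𝓚`
    have hbK : ∀ i, b i ∈ curveHull :=
      tower_mem_of_isCurveClosed curveHull isCurveClosed_curveHull hS (N + 1) b hb htow
    have hvK : v ∈ curveHull := (Submodule.span_le.2 (Set.range_subset_iff.2 hbK)) hvb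
    have hyK : ∀ j, y j ∈ curveHull := hA v hvy hv0 hvK
    -- the free family `(b', y) ⊂ 𝓚` of size `N + n`
    have hsum : LinearIndependent ℚ (Sum.elim b' y) := hb'.sum_type hy hdisj
    let e : Fin N ⊕ Fin n ≃ Fin (N + n) := finSumFinEquiv
    set T : Fin (N + n) → ℂ := Sum.elim b' y ∘ e.symm with hTdef
    have hTli : LinearIndependent ℚ T := hsum.comp _ e.symm.injective
    have hmemK : ∀ u : Fin N ⊕ Fin n, Sum.elim b' y u ∈ curveHull := by
      rintro (i | j)
      · exact hbK _
      · exact hyK j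
    have hTK : ∀ t, T t ∈ curveHull := fun t => hmemK (e.symm t)
    have hlow := hS (N + n) T hTK hTli
    -- the upper bound by rigidity along `v`
    obtain ⟨x, hx⟩ := hR v hvy hv0
    set A : Set ℂ := range b ∪ range (cexp ∘ b) with hAdef
    have hA1 : Algebra.trdeg ℚ ↥(IntermediateField.adjoin ℚ (A ∪ {cexp v})) =
        Algebra.trdeg ℚ ↥(IntermediateField.adjoin ℚ A) :=
      trdeg_adjoin_union_eq_of_isAlgebraic_adjoin A {cexp v} fun w hw => by
        rw [Set.mem_singleton_iff.1 hw]; exact isAlgebraic_exp_of_mem_span b hvb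
    have hA2 : Algebra.trdeg ℚ ↥(IntermediateField.adjoin ℚ ((A ∪ {cexp v}) ∪ range x)) ≤
        Algebra.trdeg ℚ ↥(IntermediateField.adjoin ℚ (A ∪ {cexp v})) + (s : Cardinal) :=
      (trdeg_adjoin_union_le _ _).trans (add_le_add le_rfl (trdeg_adjoin_range_le (F := ℚ) (E := ℂ) x))
    have hvA : v ∈ IntermediateField.adjoin ℚ ((A ∪ {cexp v}) ∪ range x) :=
      IntermediateField.adjoin.mono ℚ _ _ (Set.subset_union_left.trans Set.subset_union_left)
        (mem_adjoin_of_mem_span b hvb)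
    have hevA : cexp v ∈ IntermediateField.adjoin ℚ ((A ∪ {cexp v}) ∪ range x) :=
      IntermediateField.subset_adjoin ℚ _ (Or.inl (Or.inr rfl))
    have hxA : ∀ i, x i ∈ IntermediateField.adjoin ℚ ((A ∪ {cexp v}) ∪ range x) := fun i =>
      IntermediateField.subset_adjoin ℚ _ (Or.inr ⟨i, rfl⟩)
    have hA3 : Algebra.trdeg ℚ ↥(IntermediateField.adjoin ℚ (((A ∪ {cexp v}) ∪ range x) ∪ (range y ∪ range (cexp ∘ y)))) =
        Algebra.trdeg ℚ ↥(IntermediateField.adjoin ℚ ((A ∪ {cexp v}) ∪ range x)) :=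
      trdeg_adjoin_union_eq_of_isAlgebraic_adjoin _ _ fun w hw => hx _ hvA hevA hxA w hw
    have hsub : range T ∪ range (cexp ∘ T) ⊆ ((A ∪ {cexp v}) ∪ range x) ∪ (range y ∪ range (cexp ∘ y)) := by
      rintro z (⟨t, rfl⟩ | ⟨t, rfl⟩)
      · simp only [hTdef, Function.comp_apply]
        rcases e.symm t with i | j
        · exact Or.inl (Or.inl (Or.inl (Or.inl ⟨Fin.castSucc i, rfl⟩)))
        · exact Or.inr (Or.inl ⟨j, rfl⟩)
      · simp only [hTdef, Function.comp_apply]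
        rcases e.symm t with i | j
        · exact Or.inl (Or.inl (Or.inl (Or.inr ⟨Fin.castSucc i, rfl⟩)))
        · exact Or.inr (Or.inr ⟨j, rfl⟩)
    have hup := Literature.NumberTheory.Transcendental.OneMotiveToric.trdeg_mono (IntermediateField.adjoin.mono ℚ _ _ hsub)
    have hAN : Algebra.trdeg ℚ ↥(IntermediateField.adjoin ℚ A) ≤ ((N + 1 : ℕ) : Cardinal) := trdeg_le_of_towerTuple htow
    have hfinal : ((N + n : ℕ) : Cardinal) ≤ ((N + 1 : ℕ) : Cardinal) + (s : Cardinal) :=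
      calc ((N + n : ℕ) : Cardinal) ≤ _ := hlow
        _ ≤ _ := hup
        _ = _ := hA3
        _ ≤ _ := hA2
        _ = Algebra.trdeg ℚ ↥(IntermediateField.adjoin ℚ A) + (s : Cardinal) := by rw [hA1]
        _ ≤ ((N + 1 : ℕ) : Cardinal) + (s : Cardinal) := add_le_add hAN le_rfl
    norm_cast at hfinal
    omega

/-! ## 3. The witness abscissa `a₀`: the positive real root of `e^{√2·a} = e^{a} + 1` -/

/-- `a ↦ e^{√2 a} − e^a − 1` changes sign on `[0, 4]`, so it has a root in `(0, 4)`. -/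
theorem exists_root : ∃ a : ℝ, a ∈ Set.Ioo (0 : ℝ) 4 ∧ Real.exp (Real.sqrt 2 * a) = Real.exp a + 1 := by
  have hcont : ContinuousOn (fun x : ℝ => Real.exp (Real.sqrt 2 * x) - Real.exp x - 1) (Set.Icc 0 4) :=
    (by fun_prop : Continuous fun x : ℝ => Real.exp (Real.sqrt 2 * x) - Real.exp x - 1).continuousOn
  have h0 : (fun x : ℝ => Real.exp (Real.sqrt 2 * x) - Real.exp x - 1) 0 < 0 := by
    simp only [mul_zero, Real.exp_zero]; norm_num
  have h4 : (0 : ℝ) < (fun x : ℝ => Real.exp (Real.sqrt 2 * x) - Real.exp x - 1) 4 := by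
    have hs : (5 / 4 : ℝ) ≤ Real.sqrt 2 := Real.le_sqrt_of_sq_le (by norm_num)
    have h5 : Real.exp 5 ≤ Real.exp (Real.sqrt 2 * 4) := Real.exp_le_exp.2 (by linarith)
    have he : Real.exp 5 = Real.exp 1 * Real.exp 4 := by rw [← Real.exp_add]; norm_num
    have h1 : (2 : ℝ) ≤ Real.exp 1 := by have := Real.add_one_le_exp 1; linarith
    have h4' : (4 : ℝ) + 1 < Real.exp 4 := Real.add_one_lt_exp (by norm_num)
    have hmul : 2 * Real.exp 4 ≤ Real.exp 1 * Real.exp 4 := mul_le_mul_of_nonneg_right h1 (by positivity)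
    simp only
    linarith
  obtain ⟨a, ha, hfa⟩ := intermediate_value_Ioo (by norm_num : (0 : ℝ) ≤ 4) hcont ⟨h0, h4⟩
  exact ⟨a, ha, by simp only at hfa; linarith⟩

/-- **THE WITNESS ABSCISSA** `a₀ ∈ (0, 4)`: a real root of `e^{√2 a} = e^a + 1` (numerically `a₀ = 0.8553…`; the root is unique
since the function is increasing, which is not needed). -/
def a₀ : ℝ := Classical.choose exists_root

/-- The defining property of `a₀`: `a₀ ∈ (0, 4)` and `e^{√2·a₀} = e^{a₀} + 1`. -/
theorem a₀_spec : a₀ ∈ Set.Ioo (0 : ℝ) 4 ∧ Real.exp (Real.sqrt 2 * a₀) = Real.exp a₀ + 1 :=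
  Classical.choose_spec exists_root

/-- `a₀` is positive. -/
theorem a₀_pos : 0 < a₀ := a₀_spec.1.1

/-- `a₀ ≠ 0` as a complex number. -/
theorem a₀_ne_zero : (a₀ : ℂ) ≠ 0 := Complex.ofReal_ne_zero.2 a₀_pos.ne'

/-- `√2` as a complex number. -/
def rt2 : ℂ := ((Real.sqrt 2 : ℝ) : ℂ)

/-- `(√2)² = 2` in `ℂ`. -/
theorem rt2_sq : rt2 ^ 2 = 2 := by
  unfold rt2; rw [← Complex.ofReal_pow, Real.sq_sqrt (by norm_num : (0 : ℝ) ≤ 2)]; norm_num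

/-- `√2` is algebraic over `ℚ`. -/
theorem isAlgebraic_rt2 : IsAlgebraic ℚ rt2 := by
  refine IsAlgebraic.of_pow (by norm_num : 0 < 2) ?_
  rw [rt2_sq]
  have h := isAlgebraic_algebraMap (R := ℚ) (A := ℂ) 2
  rwa [map_ofNat] at h

/-- `i` is algebraic over `ℚ` (private copy; public twins exist in other cones, e.g.
`RigidCore.CalibrationB.isAlgebraic_I`). -/
private theorem isAlgebraic_I : IsAlgebraic ℚ I := by
  refine IsAlgebraic.of_pow (by norm_num : 0 < 2) ?_
  rw [Complex.I_sq]
  exact isAlgebraic_one.neg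

/-- Rational numbers are algebraic over `ℚ` (private copy; public twin
`Literature.NumberTheory.Transcendental.RoyWaldschmidt1997.isAlgebraic_ratCast`). -/
private theorem isAlgebraic_ratCast (q : ℚ) : IsAlgebraic ℚ (q : ℂ) := by
  have h := isAlgebraic_algebraMap (R := ℚ) (A := ℂ) q
  rwa [eq_ratCast] at h

/-- Integers are algebraic over `ℚ`. -/
theorem isAlgebraic_intCast (p : ℤ) : IsAlgebraic ℚ (p : ℂ) := by
  have h := isAlgebraic_ratCast (p : ℚ)
  rwa [Rat.cast_intCast] at h

/-- `E = e^{a₀}`. -/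
def E : ℂ := cexp (a₀ : ℂ)

/-- `D = e^{√2 a₀}`. -/
def D : ℂ := cexp (rt2 * a₀)

/-- `c = e^{i a₀}`. -/
def c : ℂ := cexp (I * a₀)

/-- `E = e^{a₀} ≠ 0`. -/
theorem E_ne_zero : E ≠ 0 := Complex.exp_ne_zero _

/-- `D = e^{√2·a₀} ≠ 0`. -/
theorem D_ne_zero : D ≠ 0 := Complex.exp_ne_zero _

/-- `c = e^{i·a₀} ≠ 0`. -/
theorem c_ne_zero : c ≠ 0 := Complex.exp_ne_zero _

/-- THE ALGEBRAIC LINK: `D = E + 1`, i.e. `e^{√2 a₀} = e^{a₀} + 1`. -/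
theorem D_eq : D = E + 1 := by
  unfold D E rt2
  rw [← Complex.ofReal_mul, ← Complex.ofReal_exp, ← Complex.ofReal_exp, a₀_spec.2]
  push_cast
  ring

/-- `E + 1 ≠ 0` (it equals `D`). -/
theorem E_add_one_ne_zero : E + 1 ≠ 0 := D_eq ▸ D_ne_zero


end Summit.Schanuel.Schanuel.Theorems.RootDecomp1HWitness
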